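import Literature.Computability.QuantumComplexity.ForrelationThm25Machine
import HarnessLib

/-!
# Aaronson–Ambainis Theorem 25 in `FP`, V: the machine computes the instance map (discharge)

Topic `Literature/Computability/QuantumComplexity`; last file of the discharge of the residual
named fact `AaronsonAmbainis2018_thm25_sign_encodeFP` of `ForrelationThm25Sign.lean`: the
instance map `thm25SignInstance` of AA Theorem 25 over the sign basis (S. Aaronson, A. Ambainis,
*Forrelation*, SIAM J. Comput. 47 (2018) = arXiv:1411.5729, §6, Thm. 25 and its proof, p. 27),
on codes, is computed by an `FP` function — namely `Thm25Asm.progFn ∘ Thm25Lex.lexT.eval`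
(`ForrelationThm25Lexer.lean`, `ForrelationThm25Machine.lean`; composition by `comp_mem_FP`).

This file identifies the value of the functional model `progM` of the stack program on a lexed
instance code with `(thm25SignInstance I).encode`:

* token level: the gate loop on `tokB`, `tokWEND` and the kind tokens (`loopM_tok3`), on a wire
  block (`loopM_wireTok`) and on the token block of a gate from a clean state
  (`loopM_gateToks`: the printed block `gateOut`, the tallies `gateKu`, `gateHu`, the oracle
  flag), and on a whole gate list (`loopM_gates`, `gatesM_eq`);
* shape level: the printed blocks are the list elements of the shapes of
  `ForrelationThm25Sign.blockS` (`shapesBits_blockS`, invariance under the idle-wire lift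
  `liftCircuitBy`, `shapesBits_coreS`), the odd tail prints the un-Hadamard triples of
  `hOnAllWiresS` (`shapesBits_coreS_hOnAllWiresS`), the counter modulo `4` decides the finishing
  gadget exactly as `finishS` (`finOf_qAfter`), so that the body is `shapesBits (thm25SignShapes n Q)`
  and the tally is its length (`body_eq`, `tally_eq`);
* code level: `encodeCodeList` of the circuit codes is `shapesBits` (`encodeCodeList_shapes`), whence
  **`progFn_lexT_encode : progFn (lexT.eval I.encode) = (thm25SignInstance I).encode`** (oracle
  instances included: the raised flag yields the code of `KForrelationInstance.empty`), the
  discharge **`AaronsonAmbainis2018_thm25_sign_encodeFP_holds`**, and the corollaries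
  `AaronsonAmbainis2018_thm25_sign_holds` (QSIM over `{H, Z, CZ, CCZ}` `≤ₚ` FORRELATION) and
  `aaronson_ambainis_kForrelation_complete_of_mem_of_hard` (the completeness fact from the two
  remaining named facts, membership and Lemma 24).

## References

* S. Aaronson, A. Ambainis, *Forrelation: a problem that optimally separates quantum from
  classical computing*, SIAM J. Comput. 47 (2018) 982–1038; arXiv:1411.5729, §6, Thm. 25.
* S. Arora, B. Barak, *Computational Complexity: A Modern Approach*, CUP 2009, §1.3, §6.1.
* O. Goldreich, *On promise problems: a survey*, 2006, Def. 1.4 (Karp reductions of promise problems).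
-/

namespace Literature.Computability.QuantumComplexity

open _root_.Computability Complexity Complexity.Com Cryptography Thm25Lex

namespace Thm25Asm

variable {n : ℕ}

/-! ### The gate loop on tokens -/

/-- The gate loop ignores the initial content of the stream register. [folklore] -/
theorem loopM_g_irrel : ∀ (z : List Bool) (s : St) (x : List Bool), loopM z { s with g := x } = loopM z s
  | [], _, _ => rfl
  | [_], _, _ => rfl
  | [_, _], _, _ => rfl
  | _ :: _ :: _ :: _, _, _ => rfl

/-- The handlers commute with setting the stream register. [folklore] -/
theorem actM_with_g (a b d : Bool) (s : St) (x : List Bool) :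
    actM a b d { s with g := x } = { actM a b d s with g := x } := by
  cases a <;> cases b <;> cases d <;> first | rfl | (simp only [actM, commitM]; split_ifs <;> rfl)

/-- **One token**: the loop on `a b d z` handles the token and continues on `z`. [folklore] -/
theorem loopM_tok3 (a b d : Bool) (z : List Bool) (s : St) : loopM (a :: b :: d :: z) s = loopM z (actM a b d s) := by
  rw [loopM_cons₃, actM_with_g, loopM_g_irrel]

/-- A numeral-bit token pushes its bit on the accumulator. [folklore] -/
theorem loopM_tokB (b : Bool) (z : List Bool) (s : St) : loopM (tokB b ++ z) s = loopM z { s with wa := b :: s.wa } := by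
  rw [show tokB b ++ z = false :: false :: b :: z from rfl, loopM_tok3]; rfl

/-- The bits of a numeral are accumulated (reversed). [folklore] -/
theorem loopM_bitsTok : ∀ (u : List Bool) (z : List Bool) (s : St),
    loopM (bitsTok u ++ z) s = loopM z { s with wa := u.reverse ++ s.wa }
  | [], z, s => rfl
  | b :: u, z, s => by
    rw [bitsTok_cons, List.append_assoc, loopM_tokB, loopM_bitsTok u]
    simp

/-- The end-of-numeral token commits the accumulator. [folklore] -/
theorem loopM_tokWEND (z : List Bool) (s : St) : loopM (tokWEND ++ z) s = loopM z (commitM s) := by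
  rw [show tokWEND ++ z = false :: true :: false :: z from rfl, loopM_tok3]; rfl

/-- **A wire block** loads the numeral of the wire into the next free slot. [folklore] -/
theorem loopM_wireTok (w : ℕ) (z : List Bool) (s : St) :
    loopM (wireTok w ++ z) s = loopM z (commitM { s with wa := (encodeNat w).reverse ++ s.wa }) := by
  rw [wireTok, List.append_assoc, loopM_bitsTok, loopM_tokWEND]

/-! ### A gate from a clean state -/

/-- Clean states: empty accumulator and slots, both slot flags down. [folklore] -/
structure Clean (s : St) : Prop where
  /-- accumulator -/
  hwa : s.wa = []
  /-- first slot -/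
  hw1 : s.w1 = []
  /-- second slot -/
  hw2 : s.w2 = []
  /-- third slot -/
  hw3 : s.w3 = []
  /-- first flag -/
  hf1 : s.f1 = []
  /-- second flag -/
  hf2 : s.f2 = []

/-- **The printed block of a gate**, with the dummy numerals `e₁`, `e₂`. [cite: AaronsonAmbainis2018, §6 Thm. 25 (proof)] -/
noncomputable def gateOut (e₁ e₂ : List Bool) : QGate hSign n → List Bool
  | .gate HSignOp.H e => blockH (encodeNat (signPlacementH e 0)) e₁ e₂
  | .gate HSignOp.Z e => blockZ (encodeNat (signPlacementZ e 0))
  | .gate HSignOp.CZ e => blockCZ (encodeNat (signPlacementCZ e 0)) (encodeNat (signPlacementCZ e 1))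
  | .gate HSignOp.CCZ e =>
      blockCCZ (encodeNat (signPlacementCCZ e 0)) (encodeNat (signPlacementCCZ e 1)) (encodeNat (signPlacementCCZ e 2))
  | .oracle _ _ => blockOR

/-- The number of shapes of the block of a gate (its separator included). [folklore] -/
def gateKu : QGate hSign n → ℕ
  | .gate HSignOp.H _ => 12
  | .gate HSignOp.Z _ => 4
  | .gate HSignOp.CZ _ => 4
  | .gate HSignOp.CCZ _ => 4
  | .oracle _ _ => 2

/-- The Hadamard tally of a gate. [folklore] -/
def gateHu : QGate hSign n → ℕ
  | .gate HSignOp.H _ => 1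
  | .gate HSignOp.Z _ => 0
  | .gate HSignOp.CZ _ => 0
  | .gate HSignOp.CCZ _ => 0
  | .oracle _ _ => 0

/-- Whether a gate is an oracle gate. [folklore] -/
def gateOr : QGate hSign n → Bool
  | .gate _ _ => false
  | .oracle _ _ => true

/-- The effect of the token block of a gate on a clean state. [folklore] -/
noncomputable def gateM (g : QGate hSign n) (s : St) : St :=
  { s with
    o := (gateOut s.d1 s.d2 g).reverse ++ s.o
    ku := List.replicate (gateKu g) true ++ s.ku
    hu := List.replicate (gateHu g) true ++ s.hu
    fo := bif gateOr g then [true] else s.fo }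

/-- `gateM` keeps states clean. [folklore] -/
theorem Clean.gateM {s : St} (h : Clean s) (g : QGate hSign n) : Clean (gateM g s) :=
  ⟨h.hwa, h.hw1, h.hw2, h.hw3, h.hf1, h.hf2⟩

/-- The tokens of a Hadamard gate. [folklore] -/
theorem gateToks_H (e : Fin (hSign.arity HSignOp.H) ↪ Fin n) :
    gateToks (QGate.gate (G := hSign) HSignOp.H e) = wireTok (signPlacementH e 0) ++ tokKH := by
  show (List.ofFn fun i : Fin 1 => ((signPlacementH e) i : ℕ)).flatMap wireTok ++ tokKH = _
  simp [List.ofFn_succ]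

/-- The tokens of a `Z` gate. [folklore] -/
theorem gateToks_Z (e : Fin (hSign.arity HSignOp.Z) ↪ Fin n) :
    gateToks (QGate.gate (G := hSign) HSignOp.Z e) = wireTok (signPlacementZ e 0) ++ tokKZ := by
  show (List.ofFn fun i : Fin 1 => ((signPlacementZ e) i : ℕ)).flatMap wireTok ++ tokKZ = _
  simp [List.ofFn_succ]

/-- The tokens of a `CZ` gate. [folklore] -/
theorem gateToks_CZ (e : Fin (hSign.arity HSignOp.CZ) ↪ Fin n) :
    gateToks (QGate.gate (G := hSign) HSignOp.CZ e) =
      wireTok (signPlacementCZ e 0) ++ (wireTok (signPlacementCZ e 1) ++ tokKCZ) := by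
  show (List.ofFn fun i : Fin 2 => ((signPlacementCZ e) i : ℕ)).flatMap wireTok ++ tokKCZ = _
  simp [List.ofFn_succ]

/-- The tokens of a `CCZ` gate. [folklore] -/
theorem gateToks_CCZ (e : Fin (hSign.arity HSignOp.CCZ) ↪ Fin n) :
    gateToks (QGate.gate (G := hSign) HSignOp.CCZ e) =
      wireTok (signPlacementCCZ e 0) ++ (wireTok (signPlacementCCZ e 1) ++ (wireTok (signPlacementCCZ e 2) ++ tokKCCZ)) := by
  show (List.ofFn fun i : Fin 3 => ((signPlacementCCZ e) i : ℕ)).flatMap wireTok ++ tokKCCZ = _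
  simp [List.ofFn_succ]

/-- **The token block of a gate**, processed from a clean state, prints the block of the gate,
tallies it and leaves a clean state. [cite: AaronsonAmbainis2018, §6 Thm. 25 (proof)] -/
theorem loopM_gateToks (g : QGate hSign n) (z : List Bool) (s : St) (hc : Clean s) :
    loopM (gateToks g ++ z) s = loopM z (gateM g s) := by
  obtain ⟨hwa, hw1, hw2, hw3, hf1, hf2⟩ := hc
  cases g with
  | oracle m e =>
    rw [gateToks, show tokKOR ++ z = false :: true :: true :: z from rfl, loopM_tok3]
    congr 1
    cases s; simp only at hwa hw1 hw2 hw3 hf1 hf2; subst hwa hw1 hw2 hw3 hf1 hf2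
    simp [actM, hKORM, cleanupM, gateM, gateOut, gateKu, gateHu, gateOr]
  | gate g e =>
    cases g with
    | H =>
      rw [gateToks_H, List.append_assoc, loopM_wireTok, show tokKH ++ z = true :: false :: false :: z from rfl, loopM_tok3]
      congr 1
      cases s; simp only at hwa hw1 hw2 hw3 hf1 hf2; subst hwa hw1 hw2 hw3 hf1 hf2
      simp [actM, hKHM, cleanupM, commitM, gateM, gateOut, gateKu, gateHu, gateOr]
    | Z =>
      rw [gateToks_Z, List.append_assoc, loopM_wireTok, show tokKZ ++ z = true :: false :: true :: z from rfl, loopM_tok3]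
      congr 1
      cases s; simp only at hwa hw1 hw2 hw3 hf1 hf2; subst hwa hw1 hw2 hw3 hf1 hf2
      simp [actM, hKZM, cleanupM, commitM, gateM, gateOut, gateKu, gateHu, gateOr]
    | CZ =>
      rw [gateToks_CZ, List.append_assoc, loopM_wireTok, List.append_assoc, loopM_wireTok,
        show tokKCZ ++ z = true :: true :: false :: z from rfl, loopM_tok3]
      congr 1
      cases s; simp only at hwa hw1 hw2 hw3 hf1 hf2; subst hwa hw1 hw2 hw3 hf1 hf2
      simp [actM, hKCZM, cleanupM, commitM, gateM, gateOut, gateKu, gateHu, gateOr]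
    | CCZ =>
      rw [gateToks_CCZ, List.append_assoc, loopM_wireTok, List.append_assoc, loopM_wireTok, List.append_assoc,
        loopM_wireTok, show tokKCCZ ++ z = true :: true :: true :: z from rfl, loopM_tok3]
      congr 1
      cases s; simp only at hwa hw1 hw2 hw3 hf1 hf2; subst hwa hw1 hw2 hw3 hf1 hf2
      simp [actM, hKCCZM, cleanupM, commitM, gateM, gateOut, gateKu, gateHu, gateOr]

/-- The effect of a gate list on a clean state. [folklore] -/
noncomputable def gatesM : List (QGate hSign n) → St → St
  | [], s => s
  | g :: gs, s => gatesM gs (gateM g s)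

/-- **A whole gate list** is processed block by block. [cite: AaronsonAmbainis2018, §6 Thm. 25 (proof)] -/
theorem loopM_gates : ∀ (gs : List (QGate hSign n)) (z : List Bool) (s : St), Clean s →
    loopM (gs.flatMap gateToks ++ z) s = loopM z (gatesM gs s)
  | [], z, s, _ => rfl
  | g :: gs, z, s, hc => by
    rw [List.flatMap_cons, List.append_assoc, loopM_gateToks g _ s hc, loopM_gates gs z _ (hc.gateM g), gatesM]

/-- The number of shapes printed for a gate list. [folklore] -/
def kuSum : List (QGate hSign n) → ℕ
  | [] => 0
  | g :: gs => gateKu g + kuSum gs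

/-- The number of Hadamard gates of a gate list (`= hadamardCountS`). [folklore] -/
def huSum : List (QGate hSign n) → ℕ
  | [] => 0
  | g :: gs => gateHu g + huSum gs

/-- `huSum` is the library's Hadamard count. [folklore] -/
theorem huSum_eq_hadamardCountS : ∀ gs : List (QGate hSign n), huSum gs = hadamardCountS gs
  | [] => rfl
  | .gate HSignOp.H _ :: gs => by rw [huSum, hadamardCountS, huSum_eq_hadamardCountS gs, gateHu, Nat.add_comm]
  | .gate HSignOp.Z _ :: gs => by rw [huSum, hadamardCountS, huSum_eq_hadamardCountS gs, gateHu, Nat.zero_add]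
  | .gate HSignOp.CZ _ :: gs => by rw [huSum, hadamardCountS, huSum_eq_hadamardCountS gs, gateHu, Nat.zero_add]
  | .gate HSignOp.CCZ _ :: gs => by rw [huSum, hadamardCountS, huSum_eq_hadamardCountS gs, gateHu, Nat.zero_add]
  | .oracle _ _ :: gs => by rw [huSum, hadamardCountS, huSum_eq_hadamardCountS gs, gateHu, Nat.zero_add]

/-- Whether a gate list contains an oracle gate. [folklore] -/
def anyOr : List (QGate hSign n) → Bool
  | [] => false
  | g :: gs => gateOr g || anyOr gs

/-- `anyOr` is the negation of oracle-freeness. [folklore] -/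
theorem anyOr_eq_false_iff : ∀ gs : List (QGate hSign n), anyOr gs = false ↔ ∀ g ∈ gs, g.IsOracleFree
  | [] => by simp [anyOr]
  | g :: gs => by
    rw [anyOr, Bool.or_eq_false_iff, anyOr_eq_false_iff gs]
    cases g <;> simp [gateOr, QGate.IsOracleFree]

/-- **The effect of a gate list in closed form.** [folklore] -/
theorem gatesM_eq : ∀ (gs : List (QGate hSign n)) (s : St), gatesM gs s =
    { s with
      o := (gs.flatMap (gateOut s.d1 s.d2)).reverse ++ s.o
      ku := List.replicate (kuSum gs) true ++ s.ku
      hu := List.replicate (huSum gs) true ++ s.hu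
      fo := bif anyOr gs then [true] else s.fo }
  | [], s => by simp [gatesM, kuSum, huSum, anyOr]
  | g :: gs, s => by
    rw [gatesM, gatesM_eq gs]
    simp only [gateM, List.flatMap_cons, List.reverse_append, List.append_assoc, kuSum, huSum, anyOr,
      Nat.add_comm (gateKu g), Nat.add_comm (gateHu g), List.replicate_add]
    cases gateOr g <;> simp

/-! ### The printed blocks are the list elements of the shapes -/

/-- `shapesBits` over `coreS`: block by block, each with its separator. [folklore] -/
theorem shapesBits_coreS {m : ℕ} : ∀ gs : List (QGate hSign m),
    shapesBits (coreS gs) = gs.flatMap fun g => shapesBits (blockS g ++ [.none])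
  | [] => rfl
  | g :: gs => by
    rw [coreS, List.flatMap_cons, ← shapesBits_coreS gs]
    simp [shapesBits_append]

/-- **The shapes of a gate print as its block** (dummies `m`, `m + 1` on `m + 2` bits).
[cite: AaronsonAmbainis2018, §6 Thm. 25 (proof)] -/
theorem shapesBits_blockS {m : ℕ} (g : QGate hSign m) :
    shapesBits (blockS g ++ [.none]) = gateOut (encodeNat m) (encodeNat (m + 1)) g := by
  cases g with
  | oracle k e => simp [blockS, gateOut, blockOR, shapeBits_none]
  | gate g e =>
    cases g with
    | H =>
      simp only [blockS, tripleS, gadgetS, gateOut, blockH, List.cons_append, List.nil_append, List.append_assoc,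
        shapesBits_cons, shapesBits_nil, shapeBits_two, shapeBits_none, realEmb_val, List.append_nil]
      rfl
    | Z => simp [blockS, gateOut, blockZ, shapeBits_none, shapeBits_one]
    | CZ => simp [blockS, gateOut, blockCZ, shapeBits_none, shapeBits_two]
    | CCZ => simp [blockS, gateOut, blockCCZ, shapeBits_none, shapeBits_three]

/-- Lifting a gate to `t` idle extra wires (iterating `liftGateSucc`). [folklore] -/
def liftGateBy {G : QGateSet} {m : ℕ} : (t : ℕ) → QGate G m → QGate G (m + t)
  | 0, g => g
  | t + 1, g => liftGateSucc (liftGateBy t g)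

/-- The gates of a lifted circuit are the lifted gates. [folklore] -/
theorem gates_liftCircuitBy {G : QGateSet} {m : ℕ} : ∀ (t : ℕ) (Q : QCircuit G m),
    (liftCircuitBy t Q).gates = Q.gates.map (liftGateBy t)
  | 0, Q => by simp [liftCircuitBy, liftGateBy]
  | t + 1, Q => by
    rw [liftCircuitBy, liftCircuitSucc, gates_liftCircuitBy t Q, List.map_map]
    rfl

/-- One idle wire does not change the printed block. [folklore] -/
theorem gateOut_liftGateSucc {m : ℕ} (e₁ e₂ : List Bool) (g : QGate hSign m) :
    gateOut e₁ e₂ (liftGateSucc g) = gateOut e₁ e₂ g := by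
  rcases g with ⟨_ | _ | _ | _, e⟩ | ⟨k, e⟩ <;> rfl

/-- Idle wires do not change the printed block. [folklore] -/
theorem gateOut_liftGateBy {m : ℕ} (e₁ e₂ : List Bool) : ∀ (t : ℕ) (g : QGate hSign m),
    gateOut e₁ e₂ (liftGateBy t g) = gateOut e₁ e₂ g
  | 0, _ => rfl
  | t + 1, g => by rw [liftGateBy, gateOut_liftGateSucc, gateOut_liftGateBy e₁ e₂ t g]

/-- Idle wires do not change the shape count. [folklore] -/
theorem gateKu_liftGateBy {m : ℕ} : ∀ (t : ℕ) (g : QGate hSign m), gateKu (liftGateBy t g) = gateKu g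
  | 0, _ => rfl
  | t + 1, g => by
    rw [liftGateBy, ← gateKu_liftGateBy t g]
    rcases liftGateBy t g with ⟨_ | _ | _ | _, e⟩ | ⟨k, e⟩ <;> rfl

/-- The shape count of a block. [folklore] -/
theorem length_blockS_succ {m : ℕ} (g : QGate hSign m) : (blockS g ++ [SignShape.none]).length = gateKu g := by
  rcases g with ⟨_ | _ | _ | _, e⟩ | ⟨k, e⟩ <;> rfl

/-- The length of `coreS` is the shape tally. [folklore] -/
theorem length_coreS {m : ℕ} : ∀ gs : List (QGate hSign m), (coreS gs).length = kuSum gs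
  | [] => rfl
  | g :: gs => by
    rw [coreS, List.length_append, List.length_cons, length_coreS gs, kuSum, ← length_blockS_succ g, List.length_append,
      List.length_singleton]
    omega

/-- The shape tally is invariant under idle wires. [folklore] -/
theorem kuSum_map_liftGateBy {m : ℕ} (t : ℕ) : ∀ gs : List (QGate hSign m), kuSum (gs.map (liftGateBy t)) = kuSum gs
  | [] => rfl
  | g :: gs => by rw [List.map_cons, kuSum, kuSum, gateKu_liftGateBy, kuSum_map_liftGateBy t gs]

/-- **The shapes of the (lifted) gate list print as the blocks of the gates.**
[cite: AaronsonAmbainis2018, §6 Thm. 25 (proof)] -/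
theorem shapesBits_coreS_lift (t : ℕ) (gs : List (QGate hSign n)) :
    shapesBits (coreS (gs.map (liftGateBy t))) = gs.flatMap (gateOut (encodeNat (n + t)) (encodeNat (n + t + 1))) := by
  rw [shapesBits_coreS, List.flatMap_map]
  congr 1
  funext g
  exact (shapesBits_blockS (liftGateBy t g)).trans (gateOut_liftGateBy _ _ t g)

/-- The odd-tail blocks as a range. [folklore] -/
theorem oddBlocks_eq_flatMap (d₁ d₂ : List Bool) : ∀ (j m : ℕ),
    oddBlocks d₁ d₂ j m = (List.range' j m).flatMap fun a => blockH (encodeNat a) d₁ d₂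
  | j, 0 => rfl
  | j, m + 1 => by rw [oddBlocks, List.range'_succ, List.flatMap_cons, oddBlocks_eq_flatMap d₁ d₂ (j + 1) m]

/-- **The un-Hadamard triples of the odd case print as the odd-tail blocks.**
[cite: AaronsonAmbainis2018, §6 Thm. 25 (proof)] -/
theorem shapesBits_coreS_hOnAllWiresS (m : ℕ) :
    shapesBits (coreS (hOnAllWiresS m)) = oddBlocks (encodeNat m) (encodeNat (m + 1)) 0 m := by
  have h0 : ∀ a : Fin m, shapesBits (blockS (hSignHOn a) ++ [.none]) = blockH (encodeNat (a : ℕ)) (encodeNat m) (encodeNat (m + 1)) :=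
    fun a => shapesBits_blockS (hSignHOn a)
  have h1 : shapesBits (coreS (hOnAllWiresS m)) =
      (List.finRange m).flatMap fun a : Fin m => blockH (encodeNat (a : ℕ)) (encodeNat m) (encodeNat (m + 1)) := by
    simp only [shapesBits_coreS, hOnAllWiresS, List.flatMap_map, h0]
  have h2 : oddBlocks (encodeNat m) (encodeNat (m + 1)) 0 m =
      (List.range m).flatMap fun a => blockH (encodeNat a) (encodeNat m) (encodeNat (m + 1)) := by
    rw [oddBlocks_eq_flatMap, List.range'_eq_map_range, List.flatMap_map]
    simp only [Nat.zero_add]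
  rw [h1, h2, ← List.map_coe_finRange_eq_range, List.flatMap_map]

/-! ### The counter modulo four decides the finishing gadget -/

/-- The count entering `finishS`: `h` when even, `n' + 2 + h` when odd. [cite: AaronsonAmbainis2018, §6 Thm. 25 (proof)] -/
def jOf (h m : ℕ) : ℕ := if h % 2 = 1 then m + 2 + h else h

/-- The parity bit after the Hadamard count. [folklore] -/
theorem inc4F_iterate_fst (h : ℕ) : (inc4F^[h] (false, false)).1 = decide (h % 2 = 1) := by
  rw [inc4F_iterate]

/-- The two bits of a count decide `j mod 4 = 2`. [folklore] -/
theorem decide_mod_four_eq_two (J : ℕ) : (decide (2 ≤ J % 4) && !decide (J % 2 = 1)) = decide (J % 4 = 2) := by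
  obtain h | h | h | h : J % 4 = 0 ∨ J % 4 = 1 ∨ J % 4 = 2 ∨ J % 4 = 3 := by omega
  · have h' : ¬ J % 2 = 1 := by omega
    simp [h, h']
  · have h' : J % 2 = 1 := by omega
    simp [h, h']
  · have h' : ¬ J % 2 = 1 := by omega
    simp [h, h']
  · have h' : J % 2 = 1 := by omega
    simp [h, h']

/-- **The machine's finishing decision is `finishS`'s**: the gadget is printed iff the count is
`2 mod 4` (for the counts that occur, which are even, this is `¬ 4 ∣ j`). [folklore] -/
theorem finOf_qAfter (h m : ℕ) : finOf (qAfter h m) = decide (jOf h m % 4 = 2) := by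
  unfold qAfter finOf jOf
  rw [inc4F_iterate_fst]
  by_cases hp : h % 2 = 1
  · simp only [decide_eq_true hp, ↓reduceIte, if_pos hp]
    rw [← Function.iterate_add_apply, inc4F_iterate]
    exact decide_mod_four_eq_two _
  · simp only [decide_eq_false hp, Bool.false_eq_true, ↓reduceIte, if_neg hp]
    rw [inc4F_iterate]
    exact decide_mod_four_eq_two h

/-! ### Body and tally of the machine are those of `thm25SignShapes` -/

/-- `shapesBits` of a `finishS`: the finishing part is `finBits` on the dummy numerals, printed
iff the count is not divisible by `4`. [cite: AaronsonAmbainis2018, §6 Thm. 25 (proof)] -/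
theorem shapesBits_finishS {m : ℕ} (j : ℕ) (L : List (SignShape (m + 2))) :
    shapesBits (finishS j L) = shapesBits L ++ (if j % 4 = 0 then [] else finBits (encodeNat m) (encodeNat (m + 1))) := by
  unfold finishS
  split_ifs with h
  · rw [List.append_nil]
  · simp [gadgetS, finBits, shapeBits_none, shapeBits_two]

/-- The length of a `finishS`. [folklore] -/
theorem length_finishS {m : ℕ} (j : ℕ) (L : List (SignShape (m + 2))) :
    (finishS j L).length = L.length + (if j % 4 = 0 then 0 else 4) := by
  unfold finishS
  split_ifs <;> simp [gadgetS]

/-- The shape tally of the un-Hadamard gates of the odd case. [folklore] -/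
theorem kuSum_hOnAllWiresS (m : ℕ) : kuSum (hOnAllWiresS m) = 12 * m := by
  suffices h : ∀ l : List (Fin m), kuSum (l.map hSignHOn) = 12 * l.length by
    rw [hOnAllWiresS, h, List.length_finRange]
  intro l
  induction l with
  | nil => rfl
  | cons a l ih => rw [List.map_cons, kuSum, ih, hSignHOn, gateKu, List.length_cons]; ring

/-- **The printed body is the list of the elements of the produced shapes.** With `n'` logical
wires, Hadamard count `h`, the machine prints the gate blocks, the closing separator, the odd
tail iff `h` is odd, and the finishing gadget iff the final count is `2 mod 4` — i.e. exactly
`shapesBits (thm25SignShapes n Q)`. [cite: AaronsonAmbainis2018, §6 Thm. 25 (proof, p. 27)] -/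
theorem body_eq (n : ℕ) (Q : QCircuit hSign n) :
    Q.gates.flatMap (gateOut (encodeNat (n + padCount n)) (encodeNat (n + padCount n + 1))) ++
      tailBits (decide (hadamardCountS Q.gates % 2 = 1))
        (decide (jOf (hadamardCountS Q.gates) (n + padCount n) % 4 = 2)) (n + padCount n)
        (encodeNat (n + padCount n)) (encodeNat (n + padCount n + 1)) =
    shapesBits (thm25SignShapes n Q) := by
  set h := hadamardCountS Q.gates with hh
  set n' := n + padCount n with hn'
  have hcore : shapesBits (coreS (liftCircuitBy (padCount n) Q).gates) =
      Q.gates.flatMap (gateOut (encodeNat n') (encodeNat (n' + 1))) := by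
    rw [gates_liftCircuitBy, shapesBits_coreS_lift]
  have hpar := padCount_spec n
  unfold thm25SignShapes tailBits jOf
  by_cases hev : h % 2 = 0
  · have hodd : ¬ h % 2 = 1 := by omega
    rw [if_pos hev, shapesBits_finishS, buildS, shapesBits_append, hcore, decide_eq_false hodd, if_neg hodd]
    simp only [cond_false, List.append_nil, shapesBits_cons, shapesBits_nil, shapeBits_none, List.append_assoc]
    by_cases h4 : h % 4 = 0
    · have h2 : ¬ h % 4 = 2 := by omega
      rw [if_pos h4, decide_eq_false h2]; rfl
    · have h2 : h % 4 = 2 := by omega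
      rw [if_neg h4, decide_eq_true h2]; rfl
  · have hodd : h % 2 = 1 := by omega
    rw [if_neg hev, shapesBits_finishS, oddS, buildS, shapesBits_append, hcore, decide_eq_true hodd, if_pos hodd]
    simp only [cond_true, shapesBits_cons, shapesBits_append, shapesBits_nil, shapeBits_none, List.append_nil,
      shapesBits_coreS_hOnAllWiresS, oddBits, List.append_assoc]
    by_cases h4 : (n' + 2 + h) % 4 = 0
    · have h2 : ¬ (n' + 2 + h) % 4 = 2 := by omega
      rw [if_pos h4, decide_eq_false h2]; rfl
    · have h2 : (n' + 2 + h) % 4 = 2 := by omega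
      rw [if_neg h4, decide_eq_true h2]; rfl

/-- **The tally is the number of produced shapes.** [cite: AaronsonAmbainis2018, §6 Thm. 25 (proof)] -/
theorem tally_eq (n : ℕ) (Q : QCircuit hSign n) :
    tailKu (decide (hadamardCountS Q.gates % 2 = 1))
        (decide (jOf (hadamardCountS Q.gates) (n + padCount n) % 4 = 2)) (n + padCount n) + kuSum Q.gates =
      (thm25SignShapes n Q).length := by
  set h := hadamardCountS Q.gates with hh
  set n' := n + padCount n with hn'
  have hcore : (coreS (liftCircuitBy (padCount n) Q).gates).length = kuSum Q.gates := by
    rw [gates_liftCircuitBy, length_coreS, kuSum_map_liftGateBy]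
  have hpar := padCount_spec n
  unfold thm25SignShapes tailKu jOf
  by_cases hev : h % 2 = 0
  · have hodd : ¬ h % 2 = 1 := by omega
    rw [if_pos hev, length_finishS, buildS, List.length_append, hcore, decide_eq_false hodd, if_neg hodd]
    simp only [cond_false, List.length_singleton]
    by_cases h4 : h % 4 = 0
    · have h2 : ¬ h % 4 = 2 := by omega
      rw [if_pos h4, decide_eq_false h2]; simp only [cond_false]; omega
    · have h2 : h % 4 = 2 := by omega
      rw [if_neg h4, decide_eq_true h2]; simp only [cond_true]; omega
  · have hodd : h % 2 = 1 := by omega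
    rw [if_neg hev, length_finishS, oddS, buildS, List.length_append, List.length_cons, List.length_append, hcore,
      length_coreS, kuSum_hOnAllWiresS, decide_eq_true hodd, if_pos hodd]
    simp only [cond_true, List.length_singleton]
    by_cases h4 : (n' + 2 + h) % 4 = 0
    · have h2 : ¬ (n' + 2 + h) % 4 = 2 := by omega
      rw [if_pos h4, decide_eq_false h2]; simp only [cond_false]; omega
    · have h2 : (n' + 2 + h) % 4 = 2 := by omega
      rw [if_neg h4, decide_eq_true h2]; simp only [cond_true]; omega

/-! ### The code of a FORRELATION instance, and the main identification -/

/-- `encodeCodeList` of the circuit codes of a list of shapes is `shapesBits`. [cite: AroraBarak2009, §6.1 (descriptions of circuits)] -/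
theorem encodeCodeList_shapes {N : ℕ} : ∀ L : List (SignShape N),
    encodeCodeList (L.map fun s => encodeCircuit s.toCircuit) = shapesBits L
  | [] => rfl
  | s :: L => by
    rw [List.map_cons, shapesBits_cons, ← encodeCodeList_shapes L]
    simp only [encodeCodeList, List.foldr_cons, shapeBits, boolPair_eq_rep, List.append_assoc]

/-- The code of the instance built from a list of shapes. [cite: AaronsonAmbainis2018, §6 Thm. 25 (proof)] -/
theorem encode_ofShapes {N : ℕ} (L : List (SignShape N)) :
    KForrelationInstance.encode ⟨N, L.length, fun i => (L.get i).toCircuit⟩ =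
      rep 2 (encodeNat N) ++ (false :: true :: (rep 2 (encodeNat L.length) ++ (false :: true :: shapesBits L))) := by
  rw [KForrelationInstance.encode, boolPair_eq_rep, boolPair_eq_rep, List.ofFn_comp' L.get (fun s => encodeCircuit s.toCircuit),
    List.ofFn_get, encodeCodeList_shapes]
  simp

/-- The code of the empty instance is `0101`. [folklore] -/
theorem encode_empty : KForrelationInstance.empty.encode = [false, true, false, true] := by
  rw [KForrelationInstance.empty, KForrelationInstance.encode, boolPair_eq_rep, boolPair_eq_rep, TokConv.encodeNat_zero',
    List.ofFn_zero]
  rfl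

/-- The result of the program, read off the state entering the header. [folklore] -/
theorem progFn_eq (z : List Bool) :
    progFn z =
      if (tailM (loopM (rest z) (preLoop z))).fo = [] then
        rep 2 (tailM (loopM (rest z) (preLoop z))).nb ++ (false :: true ::
          (rep 2 (encodeNat (tailM (loopM (rest z) (preLoop z))).ku.length) ++ (false :: true ::
            ((tailM (loopM (rest z) (preLoop z))).o.reverse ++ (tailM (loopM (rest z) (preLoop z))).res))))
      else false :: true :: false :: true :: (tailM (loopM (rest z) (preLoop z))).res := by
  unfold progFn progM headerM
  split_ifs <;> rfl

/-- The state entering the gate loop is clean. [folklore] -/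
theorem clean_preLoop (z : List Bool) : Clean (preLoop z) := ⟨rfl, rfl, rfl, rfl, rfl, rfl⟩

/-- **The program computes the instance map of Theorem 25 on lexed codes.** On the lexed code of
an instance `(n, Q)` the result register holds `(thm25SignInstance (n, Q)).encode` — for
oracle-free `Q` the code `⟨bin (n' + 2), ⟨bin k, shapes⟩⟩` of the FORRELATION instance of
`thm25SignShapes n Q`, otherwise the code of the empty instance.
[cite: AaronsonAmbainis2018, §6 Thm. 25 (proof, p. 27)] -/
theorem progFn_lexT_encode (I : QSimSignInstance) : progFn (lexT.eval I.encode) = (thm25SignInstance I).encode := by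
  obtain ⟨n, Q⟩ := I
  set z := lexT.eval (QSimSignInstance.encode ⟨n, Q⟩) with hz
  have hz' : z = List.replicate n true ++ false :: Q.gates.flatMap gateToks := Thm25Lex.eval_encode ⟨n, Q⟩
  have hlead : lead z = n := by rw [hz', lead_replicate]
  have hrest : rest z = Q.gates.flatMap gateToks := by rw [hz', rest_replicate]
  have hS : loopM (rest z) (preLoop z) = { gatesM Q.gates (preLoop z) with g := [] } := by
    rw [hrest, ← List.append_nil (Q.gates.flatMap gateToks), loopM_gates _ _ _ (clean_preLoop z), loopM_nil]
  rw [progFn_eq, hS, gatesM_eq]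
  simp only [tailM, preLoop, St.init, hlead, List.length_replicate, List.length_append, List.append_nil,
    padded_eq, huSum_eq_hadamardCountS, inc4F_iterate_fst, finOf_qAfter, List.reverse_append, List.reverse_reverse]
  by_cases hor : anyOr Q.gates = true
  · -- an oracle gate: outside the promise, the empty instance
    have hnot : ¬ Q.IsOracleFree := fun hfree => by
      have := (anyOr_eq_false_iff Q.gates).2 hfree
      rw [this] at hor
      exact Bool.false_ne_true hor
    rw [thm25SignInstance, if_neg hnot, encode_empty]
    simp [hor]
  · have hor' : anyOr Q.gates = false := by simpa using hor
    have hfree : QCircuit.IsOracleFree Q := (anyOr_eq_false_iff Q.gates).1 hor'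
    rw [thm25SignInstance_of_isOracleFree ⟨n, Q⟩ hfree]
    dsimp only
    rw [encode_ofShapes (thm25SignShapes n Q), hor', ← body_eq n Q, ← tally_eq n Q]
    simp

/-! ### The discharge and its corollaries -/

/-- **DISCHARGE of `AaronsonAmbainis2018_thm25_sign_encodeFP`**: the instance map of AA
Theorem 25 over the sign basis, on codes, is computed by the `FP` function
`progFn ∘ lexT.eval` (a finite-state lexer followed by a polynomial-time stack program;
composition by `comp_mem_FP`). [cite: AaronsonAmbainis2018, §6 Thm. 25 ("polynomial-time reducible"; proof, p. 27)] -/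
theorem _root_.Literature.Computability.QuantumComplexity.AaronsonAmbainis2018_thm25_sign_encodeFP_holds :
    AaronsonAmbainis2018_thm25_sign_encodeFP :=
  ⟨progFn ∘ lexT.eval, comp_mem_FP progFn_mem_FP lexT_eval_mem_FP, fun I => progFn_lexT_encode I⟩

/-- **AA Theorem 25 over the sign basis (discharged)**: QSIM over `{H, Z, CZ, CCZ}` Karp-reduces in
polynomial time to explicit `k`-fold FORRELATION. [cite: AaronsonAmbainis2018, §6 Thm. 25] -/
theorem _root_.Literature.Computability.QuantumComplexity.AaronsonAmbainis2018_thm25_sign_holds :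
    AaronsonAmbainis2018_thm25_sign :=
  AaronsonAmbainis2018_thm25_sign_of_encodeFP AaronsonAmbainis2018_thm25_sign_encodeFP_holds

/-- **The completeness fact from the two remaining named facts**: membership of explicit `k`-fold
FORRELATION in `PromiseBQP` (AA p. 26 via Prop. 6) and `PromiseBQP`-hardness of QSIM over the
sign basis (Lemma 24); the reduction of Theorem 25 is now proved.
[cite: AaronsonAmbainis2018, §6 (Prop. 6, Lemma 24, Thm. 25)] -/
theorem _root_.Literature.Computability.QuantumComplexity.aaronson_ambainis_kForrelation_complete_of_mem_of_hard
    (hmem : AaronsonAmbainis2018_kForrelation_mem) (h24 : AaronsonAmbainis2018_lemma24_sign_hard) :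
    aaronson_ambainis_kForrelation_complete :=
  aaronson_ambainis_kForrelation_complete_of_sign_encodeFP hmem h24 AaronsonAmbainis2018_thm25_sign_encodeFP_holds

end Thm25Asm

end Literature.Computability.QuantumComplexity
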